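import Literature.Computability.AlgebraicComplexity.GenericStabilizerCountingCore
import HarnessLib

/-!
# Counting core for the generic trivial stabiliser — the case `D = 4`

Topic `Literature/Computability/AlgebraicComplexity`; theorems only. Sequel to
`GenericStabilizerCountingCore.lean` (val-lit-p4 g5, Brick C of x3 g3's programme for
`BI2017_matsumuraMonsky_trivialStabilizer`, Bürgisser–Ikenmeyer 2017 §2.1 / Matsumura–Monsky 1964):
the inequality `#{e ⊢ 4 : c^e = 1} + #{(i,j) : c_i ≠ c_j} + 1 ≤ #{e ⊢ 4}` for every non-constant
`c : [m] → K`, `m ≥ 3` (`core_four`, and `card_invMonomials_add_card_lt_four` in the chart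
vocabulary of `StabilizerEigenbasisCharts.lean`).

The charge of `GenericStabilizerCountingCore` (`(i,j) ↦ x_i x_j^3` if bad, else `x_i^2 x_j^2`) is
injective except for SPECIAL pairs (`x_i x_j^3` and `x_j x_i^3` both good, i.e.
`c_i c_j^3 = c_i^3 c_j = 1`, forcing `c_i^4 ≠ 1 ≠ c_j^4`), where both orientations would take
`x_i^2 x_j^2`. For the larger letter `i` of a special pair the partners below `i` form a set `T(i)` with
least element `b₀(i)`; we charge `(i, b₀(i)) ↦ x_i^4` and `(i, b) ↦ x_b x_{b₀(i)} x_i^2` (`b ∈ T(i)`,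
`b ≠ b₀(i)`; value `c_i^{-4} ≠ 1`), and `(b, i) ↦ x_b^2 x_i^2`. The left-over bad monomial is
`x_{a₀}^4` for the least `a₀` with `c_{a₀}^4 ≠ 1` (never charged: a special partner below `a₀` would
have a bad fourth power too), and when all fourth powers are good every `x_i x_j^3` (`c_i ≠ c_j`) is
bad, the charge is the plain one, and a bad THREE-letter monomial `x_{i₀}^2 x_{j₀} x_l` or
`x_{i₀} x_{j₀}^2 x_l` is left over. Injectivity is read off the exponent patterns
`(1,3) / (2,2) / (4) / (1,1,2)` (pattern lemmas of §1).

HONEST FRAMING: elementary counting inside a classical genericity theorem, filed as literature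
bookkeeping; VP ≠ VNP is NOT proved and nothing in this file is progress on it.
[cite: BurgisserIkenmeyer2017, §2.1 (before Thm. 2.3)]
-/

noncomputable section

open scoped BigOperators

namespace Literature.Computability.AlgebraicComplexity

namespace TrivialStabilizerCount

open scoped Classical

variable {K : Type*} [Field K] {m : ℕ}

/-! ### More pattern lemmas (degree `4`) -/

/-- `x_i x_j^3 ≠ x_{i'}^2 x_{j'}^2` (`i ≠ j`). [cite: BurgisserIkenmeyer2017, §2.1 (generic stabilizer; Matsumura–Monsky)] -/
theorem one_three_ne_two_two {i j i' j' : Fin m} (hij : i ≠ j) :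
    Finsupp.single i 1 + Finsupp.single j 3 ≠ Finsupp.single i' 2 + Finsupp.single j' 2 := by
  intro h
  have hi := DFunLike.congr_fun h i
  rw [two_apply, two_apply, if_pos rfl, if_neg (Ne.symm hij)] at hi
  by_cases h1 : i' = i <;> by_cases h2 : j' = i <;> simp only [h1, h2, if_true, if_false] at hi <;> omega

/-- A two-letter exponent vector with positive exponents on distinct letters is not a pure power.
[cite: BurgisserIkenmeyer2017, §2.1 (generic stabilizer; Matsumura–Monsky)] -/
theorem two_ne_single {i j k : Fin m} {a b n : ℕ} (hij : i ≠ j) (ha : 0 < a) (hb : 0 < b) :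
    Finsupp.single i a + Finsupp.single j b ≠ Finsupp.single k n := by
  intro h
  have hi := DFunLike.congr_fun h i
  have hj := DFunLike.congr_fun h j
  rw [two_apply, if_pos rfl, if_neg (Ne.symm hij), Finsupp.single_apply] at hi
  rw [two_apply, if_neg hij, if_pos rfl, Finsupp.single_apply] at hj
  by_cases hk : k = i
  · rw [if_neg (fun h' => hij (hk.symm.trans h'))] at hj
    omega
  · rw [if_neg hk] at hi
    omega

/-- A pure power is not an exponent vector with three letters of positive exponent.
[cite: BurgisserIkenmeyer2017, §2.1 (generic stabilizer; Matsumura–Monsky)] -/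
theorem single_ne_of_three_pos {k : Fin m} {n : ℕ} {g : Fin m →₀ ℕ} {p q r : Fin m}
    (hpq : p ≠ q) (hqr : q ≠ r) (hpr : p ≠ r) (hp : 0 < g p) (hq : 0 < g q) (hr : 0 < g r) :
    Finsupp.single k n ≠ g := by
  rw [show Finsupp.single k n = Finsupp.single k n + Finsupp.single k 0 by simp]
  exact two_ne_of_three_pos hpq hqr hpr hp hq hr

/-- `x_i^2 x_j^2 = x_{i'}^2 x_{j'}^2` (`i ≠ j`) forces `{i,j} = {i',j'}`.
[cite: BurgisserIkenmeyer2017, §2.1 (generic stabilizer; Matsumura–Monsky)] -/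
theorem two_two_eq_two_two {i j i' j' : Fin m} (hij : i ≠ j)
    (h : Finsupp.single i 2 + Finsupp.single j 2 = Finsupp.single i' 2 + Finsupp.single j' 2) :
    (i' = i ∧ j' = j) ∨ (i' = j ∧ j' = i) := by
  have hi := DFunLike.congr_fun h i
  have hj := DFunLike.congr_fun h j
  rw [two_apply, two_apply, if_pos rfl, if_neg (Ne.symm hij)] at hi
  rw [two_apply, two_apply, if_neg hij, if_pos rfl] at hj
  by_cases h1 : i' = i
  · left
    refine ⟨h1, ?_⟩
    rw [if_neg (fun h' => hij (h1.symm.trans h'))] at hj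
    by_cases h2 : j' = j
    · exact h2
    · rw [if_neg h2] at hj; omega
  · right
    rw [if_neg h1] at hi
    by_cases h2 : j' = i
    · refine ⟨?_, h2⟩
      rw [if_neg (fun h' : j' = j => hij (h2.symm.trans h'))] at hj
      by_cases h3 : i' = j
      · exact h3
      · rw [if_neg h3] at hj; omega
    · rw [if_neg h2] at hi; omega

/-- `x_b x_{b₀} x_a^2 = x_d x_{d₀} x_{a'}^2` with `b, b₀ ≠ a` and `d ≠ d₀` forces `a = a'` (the letter of
exponent `2`). [cite: BurgisserIkenmeyer2017, §2.1 (generic stabilizer; Matsumura–Monsky)] -/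
theorem one_one_two_eq_fst {b b₀ a d d₀ a' : Fin m} (hba : b ≠ a) (hb₀a : b₀ ≠ a) (hd : d ≠ d₀)
    (h : Finsupp.single b 1 + Finsupp.single b₀ 1 + Finsupp.single a 2 =
      Finsupp.single d 1 + Finsupp.single d₀ 1 + Finsupp.single a' 2) : a = a' := by
  have ha := DFunLike.congr_fun h a
  rw [three_apply, three_apply, if_neg hba, if_neg hb₀a, if_pos rfl] at ha
  by_contra hne
  rw [if_neg (Ne.symm hne)] at ha
  by_cases h1 : d = a <;> by_cases h2 : d₀ = a
  · exact hd (h1.trans h2.symm)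
  all_goals simp only [h1, h2, if_true, if_false] at ha; omega

/-- … and then, if the exponent-`1` letters `b₀ = d₀` agree, also `b = d`.
[cite: BurgisserIkenmeyer2017, §2.1 (generic stabilizer; Matsumura–Monsky)] -/
theorem one_one_two_eq_snd {b b₀ a d a' : Fin m} (hb : b ≠ b₀) (hba : b ≠ a) (haa : a = a')
    (h : Finsupp.single b 1 + Finsupp.single b₀ 1 + Finsupp.single a 2 =
      Finsupp.single d 1 + Finsupp.single b₀ 1 + Finsupp.single a' 2) : b = d := by
  subst haa
  have hbb := DFunLike.congr_fun h b
  rw [three_apply, three_apply, if_pos rfl, if_neg (Ne.symm hb), if_neg (Ne.symm hba)] at hbb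
  by_cases h1 : d = b
  · exact h1.symm
  · rw [if_neg h1] at hbb; omega

/-! ### Algebra of special pairs -/

/-- If `c_i c_j^3 = 1`, `c_i^3 c_j = 1` and `c_i ≠ c_j` then `c_j^4 ≠ 1`.
[cite: BurgisserIkenmeyer2017, §2.1 (generic stabilizer; Matsumura–Monsky)] -/
theorem pow_four_ne_one_of_special {c : Fin m → K} {i j : Fin m} (hij : c i ≠ c j)
    (h1 : c i * c j ^ 3 = 1) : c j ^ 4 ≠ 1 := by
  intro h4
  apply hij
  have hj0 : c j ^ 3 ≠ 0 := by
    intro h0; rw [h0, mul_zero] at h1; exact zero_ne_one h1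
  have : c i * c j ^ 3 = c j * c j ^ 3 := by
    rw [h1]
    calc (1 : K) = c j ^ 4 := h4.symm
      _ = c j * c j ^ 3 := by ring
  exact mul_right_cancel₀ hj0 this

/-- Positivity of the three letters of `x_b x_{b₀} x_a^2`. [cite: BurgisserIkenmeyer2017, §2.1 (generic stabilizer; Matsumura–Monsky)] -/
theorem one_one_two_pos {b b₀ a : Fin m} (hb : b ≠ b₀) (hba : b ≠ a) (hb₀a : b₀ ≠ a) :
    0 < (Finsupp.single b 1 + Finsupp.single b₀ 1 + Finsupp.single a 2 : Fin m →₀ ℕ) b ∧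
    0 < (Finsupp.single b 1 + Finsupp.single b₀ 1 + Finsupp.single a 2 : Fin m →₀ ℕ) b₀ ∧
    0 < (Finsupp.single b 1 + Finsupp.single b₀ 1 + Finsupp.single a 2 : Fin m →₀ ℕ) a := by
  refine ⟨?_, ?_, ?_⟩ <;> rw [three_apply]
  · rw [if_pos rfl]; omega
  · rw [if_neg hb, if_pos rfl]; omega
  · rw [if_neg hba, if_neg hb₀a, if_pos rfl]; omega

/-! ### The case `D = 4` -/

/-- **Counting core, `D = 4`, `m ≥ 3`.** For a non-constant `c : [m] → K`,
`#{e ⊢ 4 : c^e = 1} + #{(i,j) : c_i ≠ c_j} + 1 ≤ #{e ⊢ 4}`. The cross pair `(i,j)` is charged to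
`x_i x_j^3` if bad; else to `x_i^2 x_j^2` (bad) unless the reversed pair would also be charged to it,
i.e. unless both `x_i x_j^3` and `x_j x_i^3` are good (`c_i c_j^3 = c_i^3 c_j = 1`, which forces
`c_i^4 ≠ 1 ≠ c_j^4`): such SPECIAL pairs are charged, by their larger letter `i`, to `x_i^2 x_j^2`
(`j > i`), to `x_i^4` (`j = b₀(i)`, the least special partner of `i` below `i`) and to the bad three-letter
monomials `x_j x_{b₀(i)} x_i^2` (value `c_i^{-4}`). The left-over bad monomial is `x_{a₀}^4` for the
least `a₀` with `c_{a₀}^4 ≠ 1` if there is one (a special partner of `a₀` below `a₀` would contradict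
minimality), and otherwise (all `c_a^4 = 1`, where every `x_i x_j^3` with `c_i ≠ c_j` is bad) a bad
three-letter monomial `x_{i₀}^2 x_{j₀} x_l` or `x_{i₀} x_{j₀}^2 x_l`.
[cite: BurgisserIkenmeyer2017, §2.1 (generic stabilizer; Matsumura–Monsky)] -/
theorem core_four (hm : 3 ≤ m) (c : Fin m → K) (hnc : ∃ i j, c i ≠ c j) :
    ((degMonomials (Fin m) 4).filter fun e => ∏ t, c t ^ e t = 1).card +
      (Finset.univ.filter fun p : Fin m × Fin m => c p.1 ≠ c p.2).card + 1 ≤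
        (degMonomials (Fin m) 4).card := by
  obtain ⟨i₀, j₀, h0⟩ := hnc
  have hij₀ : i₀ ≠ j₀ := fun h => h0 (h ▸ rfl)
  obtain ⟨l, hli, hlj⟩ := exists_ne_ne hm i₀ j₀
  -- the monomials of the construction
  let A : Fin m × Fin m → (Fin m →₀ ℕ) := fun p => Finsupp.single p.1 1 + Finsupp.single p.2 3
  let B : Fin m × Fin m → (Fin m →₀ ℕ) := fun p => Finsupp.single p.1 2 + Finsupp.single p.2 2
  let gd : (Fin m →₀ ℕ) → Prop := fun e => ∏ t, c t ^ e t = 1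
  -- special partners of `i` below `i`, and the least one
  let T : Fin m → Finset (Fin m) := fun i =>
    Finset.univ.filter fun b => b < i ∧ gd (A (b, i)) ∧ gd (A (i, b))
  let b₀ : Fin m → Fin m := fun i => if h : (T i).Nonempty then (T i).min' h else i
  let Dm : Fin m × Fin m → (Fin m →₀ ℕ) := fun p =>
    Finsupp.single p.2 1 + Finsupp.single (b₀ p.1) 1 + Finsupp.single p.1 2
  let Ψ : Fin m × Fin m → (Fin m →₀ ℕ) := fun p =>
    if ¬ gd (A p) then A p
    else if ¬ gd (A p.swap) ∨ p.1 < p.2 then B p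
    else if p.2 = b₀ p.1 then Finsupp.single p.1 4
    else Dm p
  -- values
  have hA : ∀ p : Fin m × Fin m, (∏ t, c t ^ A p t) = c p.1 ^ 1 * c p.2 ^ (2 + 1) * 1 := by
    intro p
    show ∏ t, c t ^ ((Finsupp.single p.1 1 + Finsupp.single p.2 3 : Fin m →₀ ℕ) t) = _
    rw [prod_pow_two, mul_one]
  have hB : ∀ p : Fin m × Fin m, (∏ t, c t ^ B p t) = c p.1 ^ (1 + 1) * c p.2 ^ 2 * 1 := by
    intro p
    show ∏ t, c t ^ ((Finsupp.single p.1 2 + Finsupp.single p.2 2 : Fin m →₀ ℕ) t) = _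
    rw [prod_pow_two, mul_one]
  have hA' : ∀ p : Fin m × Fin m, gd (A p) ↔ c p.1 * c p.2 ^ 3 = 1 := by
    intro p
    show (∏ t, c t ^ A p t) = 1 ↔ _
    rw [hA, pow_one, mul_one]
  have hS : ∀ a : Fin m, (∏ t, c t ^ (Finsupp.single a 4 : Fin m →₀ ℕ) t) = c a ^ 4 := fun a =>
    prod_pow_single_apply c a 4
  have hDm : ∀ p : Fin m × Fin m, (∏ t, c t ^ Dm p t) = c p.2 ^ 1 * c (b₀ p.1) ^ 1 * c p.1 ^ 2 := by
    intro p
    show ∏ t, c t ^ ((Finsupp.single p.2 1 + Finsupp.single (b₀ p.1) 1 + Finsupp.single p.1 2 :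
      Fin m →₀ ℕ) t) = _
    rw [prod_pow_three]
  -- membership in `T`
  have hT : ∀ i b : Fin m, b ∈ T i ↔ b < i ∧ gd (A (b, i)) ∧ gd (A (i, b)) := fun i b => by
    show b ∈ Finset.univ.filter _ ↔ _
    rw [Finset.mem_filter]
    simp only [Finset.mem_univ, true_and]
  -- in the special branch: `p.2 ∈ T p.1`, and `b₀ p.1` is the least element of `T p.1`
  have hspec : ∀ p : Fin m × Fin m, c p.1 ≠ c p.2 → gd (A p) → ¬ (¬ gd (A p.swap) ∨ p.1 < p.2) →
      p.2 ∈ T p.1 ∧ b₀ p.1 ∈ T p.1 ∧ b₀ p.1 ≤ p.2 := by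
    intro p hp h1 h2
    push Not at h2
    have hne : p.1 ≠ p.2 := fun h => hp (by rw [h])
    have hlt : p.2 < p.1 := lt_of_le_of_ne h2.2 (Ne.symm hne)
    have hmem : p.2 ∈ T p.1 := (hT p.1 p.2).mpr ⟨hlt, h2.1, h1⟩
    have hne' : (T p.1).Nonempty := ⟨p.2, hmem⟩
    have hb₀ : b₀ p.1 = (T p.1).min' hne' := by
      show (if h : (T p.1).Nonempty then (T p.1).min' h else p.1) = _
      rw [dif_pos hne']
    refine ⟨hmem, ?_, ?_⟩
    · rw [hb₀]; exact Finset.min'_mem _ _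
    · rw [hb₀]; exact Finset.min'_le _ _ hmem
  -- special pairs: from `x_j x_i^3` good and `c_j ≠ c_i`, `c_i^4 ≠ 1`; members of `T i` then have
  -- `c_b ≠ c_i`, both relations, and `c_b^4 ≠ 1`
  have hT4 : ∀ i b : Fin m, c i ^ 4 ≠ 1 → b ∈ T i →
      c b ≠ c i ∧ c b * c i ^ 3 = 1 ∧ c i * c b ^ 3 = 1 ∧ c b ^ 4 ≠ 1 := by
    intro i b hi4 hb
    obtain ⟨-, hgd1, hgd2⟩ := (hT i b).mp hb
    rw [hA'] at hgd1 hgd2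
    have hne : c b ≠ c i := by
      intro h
      apply hi4
      calc c i ^ 4 = c b * c i ^ 3 := by rw [h]; ring
        _ = 1 := hgd1
    exact ⟨hne, hgd1, hgd2, pow_four_ne_one_of_special hne.symm hgd2⟩
  have hsp4 : ∀ p : Fin m × Fin m, c p.1 ≠ c p.2 → gd (A p.swap) → c p.1 ^ 4 ≠ 1 := by
    intro p hp h
    rw [hA'] at h
    exact pow_four_ne_one_of_special (Ne.symm hp) h
  -- the four branches of `Ψ`
  have hΨA : ∀ p, ¬ gd (A p) → Ψ p = A p := fun p h => by
    show (if ¬ gd (A p) then A p else _) = _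
    rw [if_pos h]
  have hΨB : ∀ p, gd (A p) → (¬ gd (A p.swap) ∨ p.1 < p.2) → Ψ p = B p := fun p h1 h2 => by
    show (if ¬ gd (A p) then A p else if ¬ gd (A p.swap) ∨ p.1 < p.2 then B p else _) = _
    rw [if_neg (not_not.mpr h1), if_pos h2]
  have hΨC : ∀ p, gd (A p) → ¬ (¬ gd (A p.swap) ∨ p.1 < p.2) → p.2 = b₀ p.1 →
      Ψ p = Finsupp.single p.1 4 := fun p h1 h2 h3 => by
    show (if ¬ gd (A p) then A p else if ¬ gd (A p.swap) ∨ p.1 < p.2 then B p else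
      if p.2 = b₀ p.1 then Finsupp.single p.1 4 else Dm p) = _
    rw [if_neg (not_not.mpr h1), if_neg h2, if_pos h3]
  have hΨD : ∀ p, gd (A p) → ¬ (¬ gd (A p.swap) ∨ p.1 < p.2) → p.2 ≠ b₀ p.1 → Ψ p = Dm p :=
    fun p h1 h2 h3 => by
    show (if ¬ gd (A p) then A p else if ¬ gd (A p.swap) ∨ p.1 < p.2 then B p else
      if p.2 = b₀ p.1 then Finsupp.single p.1 4 else Dm p) = _
    rw [if_neg (not_not.mpr h1), if_neg h2, if_neg h3]
  -- in the special branch, the three letters of `Dm p` are distinct and `Dm p`, `x_{p.1}^4` are bad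
  have hspecial : ∀ p : Fin m × Fin m, c p.1 ≠ c p.2 → gd (A p) → ¬ (¬ gd (A p.swap) ∨ p.1 < p.2) →
      c p.1 ^ 4 ≠ 1 ∧ b₀ p.1 ≠ p.1 ∧ p.2 ≠ p.1 ∧ c (b₀ p.1) ^ 4 ≠ 1 ∧ c p.2 ^ 4 ≠ 1 ∧
        ¬ gd (Dm p) := by
    intro p hp h1 h2
    have h2' := h2
    push Not at h2'
    obtain ⟨hmem, hb₀mem, -⟩ := hspec p hp h1 h2
    have hi4 := hsp4 p hp h2'.1
    obtain ⟨_, hb1, -, hb4⟩ := hT4 p.1 (b₀ p.1) hi4 hb₀mem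
    obtain ⟨_, hq1, -, hq4⟩ := hT4 p.1 p.2 hi4 hmem
    refine ⟨hi4, ne_of_lt ((hT p.1 _).mp hb₀mem).1, ne_of_lt ((hT p.1 _).mp hmem).1, hb4, hq4, ?_⟩
    intro hgd
    apply hi4
    have hval : c p.2 ^ 1 * c (b₀ p.1) ^ 1 * c p.1 ^ 2 = 1 := by rw [← hDm]; exact hgd
    calc c p.1 ^ 4 = c p.2 ^ 1 * c (b₀ p.1) ^ 1 * c p.1 ^ 2 * c p.1 ^ 4 := by rw [hval, one_mul]
      _ = (c p.2 * c p.1 ^ 3) * (c (b₀ p.1) * c p.1 ^ 3) := by ring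
      _ = 1 := by rw [hq1, hb1, one_mul]
  -- the left-over monomial
  let V1 : Fin m →₀ ℕ := Finsupp.single i₀ 2 + Finsupp.single j₀ 1 + Finsupp.single l 1
  let V2 : Fin m →₀ ℕ := Finsupp.single i₀ 1 + Finsupp.single j₀ 2 + Finsupp.single l 1
  let Bad4 : Finset (Fin m) := Finset.univ.filter fun a => ¬ gd (Finsupp.single a 4)
  let e₀ : Fin m →₀ ℕ :=
    if h : Bad4.Nonempty then Finsupp.single (Bad4.min' h) 4 else if ¬ gd V1 then V1 else V2
  have hV1 : (∏ t, c t ^ V1 t) = c i₀ ^ (1 + 1) * c j₀ ^ 1 * c l ^ 1 := by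
    show ∏ t, c t ^ ((Finsupp.single i₀ 2 + Finsupp.single j₀ 1 + Finsupp.single l 1 : Fin m →₀ ℕ) t) = _
    rw [prod_pow_three]
  have hV2 : (∏ t, c t ^ V2 t) = c i₀ ^ 1 * c j₀ ^ (1 + 1) * c l ^ 1 := by
    show ∏ t, c t ^ ((Finsupp.single i₀ 1 + Finsupp.single j₀ 2 + Finsupp.single l 1 : Fin m →₀ ℕ) t) = _
    rw [prod_pow_three]
  have hBad4 : ∀ a, a ∈ Bad4 ↔ c a ^ 4 ≠ 1 := fun a => by
    show a ∈ Finset.univ.filter _ ↔ _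
    rw [Finset.mem_filter]
    simp only [Finset.mem_univ, true_and]
    show ¬ (∏ t, c t ^ (Finsupp.single a 4 : Fin m →₀ ℕ) t) = 1 ↔ _
    rw [hS]
  -- when all fourth powers are good, every `x_i x_j^3` with `c_i ≠ c_j` is bad
  have hallA : ¬ Bad4.Nonempty → ∀ p : Fin m × Fin m, c p.1 ≠ c p.2 → ¬ gd (A p) := by
    intro hB p hp hgd
    have h4 : c p.2 ^ 4 = 1 := by
      by_contra h
      exact hB ⟨p.2, (hBad4 p.2).mpr h⟩
    rw [hA'] at hgd
    apply hp
    have hne : c p.2 ^ 3 ≠ 0 := by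
      intro h0; rw [h0, mul_zero] at hgd; exact zero_ne_one hgd
    have : c p.1 * c p.2 ^ 3 = c p.2 * c p.2 ^ 3 := by
      rw [hgd]
      calc (1 : K) = c p.2 ^ 4 := h4.symm
        _ = c p.2 * c p.2 ^ 3 := by ring
    exact mul_right_cancel₀ hne this
  refine core_of_injection 4 c Ψ e₀ ?_ ?_ ?_ ?_ ?_ ?_
  · -- `e₀` has degree `4`
    show (if h : Bad4.Nonempty then Finsupp.single (Bad4.min' h) 4 else if ¬ gd V1 then V1 else V2) ∈ _
    split_ifs
    · rw [mem_degMonomials_iff, Finsupp.degree_single]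
    · exact single_add_single_add_single_mem _ _ _ rfl
    · exact single_add_single_add_single_mem _ _ _ rfl
  · -- `e₀` is bad
    show ¬ (∏ t, c t ^ (if h : Bad4.Nonempty then Finsupp.single (Bad4.min' h) 4
      else if ¬ gd V1 then V1 else V2) t) = 1
    split_ifs with h h'
    · have := Finset.min'_mem Bad4 h
      rw [hBad4] at this
      rwa [hS]
    · intro hV2good
      rw [hV2] at hV2good
      have hV1good : c i₀ ^ (1 + 1) * c j₀ ^ 1 * c l ^ 1 = 1 := by rw [← hV1]; exact h'
      exact not_both_one_of_ne h0 1 1 _ hV1good hV2good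
    · exact h'
  · -- the charged monomials have degree `4`
    intro p hp
    by_cases h1 : gd (A p)
    · by_cases h2 : ¬ gd (A p.swap) ∨ p.1 < p.2
      · rw [hΨB p h1 h2]; exact single_add_single_mem _ _ rfl
      · by_cases h3 : p.2 = b₀ p.1
        · rw [hΨC p h1 h2 h3, mem_degMonomials_iff, Finsupp.degree_single]
        · rw [hΨD p h1 h2 h3]; exact single_add_single_add_single_mem _ _ _ rfl
    · rw [hΨA p h1]; exact single_add_single_mem _ _ rfl
  · -- every charged monomial is bad
    intro p hp
    by_cases h1 : gd (A p)
    · by_cases h2 : ¬ gd (A p.swap) ∨ p.1 < p.2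
      · rw [hΨB p h1 h2]
        intro hB'
        rw [hB] at hB'
        have hA1 : c p.1 ^ 1 * c p.2 ^ (2 + 1) * 1 = 1 := by rw [← hA]; exact h1
        exact not_both_one_of_ne hp 1 2 1 hB' hA1
      · by_cases h3 : p.2 = b₀ p.1
        · rw [hΨC p h1 h2 h3]
          show ¬ (∏ t, c t ^ (Finsupp.single p.1 4 : Fin m →₀ ℕ) t) = 1
          rw [hS]
          exact (hspecial p hp h1 h2).1
        · rw [hΨD p h1 h2 h3]
          exact (hspecial p hp h1 h2).2.2.2.2.2
    · rw [hΨA p h1]; exact h1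
  · -- the charged monomials miss `e₀`
    intro p hp
    by_cases hB4 : Bad4.Nonempty
    · have he : e₀ = Finsupp.single (Bad4.min' hB4) 4 := by
        show (if h : Bad4.Nonempty then Finsupp.single (Bad4.min' h) 4 else _) = _
        rw [dif_pos hB4]
      rw [he]
      by_cases h1 : gd (A p)
      · by_cases h2 : ¬ gd (A p.swap) ∨ p.1 < p.2
        · rw [hΨB p h1 h2]
          exact two_ne_single (fun h => hp (by rw [h])) (by norm_num) (by norm_num)
        · obtain ⟨hi4, hb₀ne, hp2ne, hb4, hq4, -⟩ := hspecial p hp h1 h2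
          by_cases h3 : p.2 = b₀ p.1
          · rw [hΨC p h1 h2 h3]
            intro heq
            have hp1 : p.1 = Bad4.min' hB4 := (Finsupp.single_left_inj (by norm_num)).mp heq
            -- `p.2 ∈ Bad4` and `p.2 < p.1 = min' Bad4`: contradiction
            have hmem : p.2 ∈ Bad4 := (hBad4 p.2).mpr hq4
            have hle := Finset.min'_le Bad4 p.2 hmem
            have hlt : p.2 < p.1 := ((hT p.1 p.2).mp (hspec p hp h1 h2).1).1
            rw [hp1] at hlt
            exact absurd hle (not_le.mpr hlt)
          · rw [hΨD p h1 h2 h3]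
            have hpos := one_one_two_pos h3 hp2ne hb₀ne
            exact (single_ne_of_three_pos h3 hb₀ne (hp2ne) hpos.1 hpos.2.1 hpos.2.2).symm
      · rw [hΨA p h1]
        exact two_ne_single (fun h => hp (by rw [h])) (by norm_num) (by norm_num)
    · -- all fourth powers good: `Ψ p = A p`, and `e₀ ∈ {V1, V2}` has three letters
      rw [hΨA p (hallA hB4 p hp)]
      have hpos : ∀ e : Fin m →₀ ℕ, (e = V1 ∨ e = V2) → 0 < e i₀ ∧ 0 < e j₀ ∧ 0 < e l := by
        rintro e (rfl | rfl)
        · show 0 < (Finsupp.single i₀ 2 + Finsupp.single j₀ 1 + Finsupp.single l 1 : Fin m →₀ ℕ) i₀ ∧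
            0 < (Finsupp.single i₀ 2 + Finsupp.single j₀ 1 + Finsupp.single l 1 : Fin m →₀ ℕ) j₀ ∧
            0 < (Finsupp.single i₀ 2 + Finsupp.single j₀ 1 + Finsupp.single l 1 : Fin m →₀ ℕ) l
          refine ⟨?_, ?_, ?_⟩ <;> rw [three_apply]
          · rw [if_pos rfl]; omega
          · rw [if_neg hij₀, if_pos rfl]; omega
          · rw [if_neg (Ne.symm hli), if_neg (Ne.symm hlj), if_pos rfl]; omega
        · show 0 < (Finsupp.single i₀ 1 + Finsupp.single j₀ 2 + Finsupp.single l 1 : Fin m →₀ ℕ) i₀ ∧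
            0 < (Finsupp.single i₀ 1 + Finsupp.single j₀ 2 + Finsupp.single l 1 : Fin m →₀ ℕ) j₀ ∧
            0 < (Finsupp.single i₀ 1 + Finsupp.single j₀ 2 + Finsupp.single l 1 : Fin m →₀ ℕ) l
          refine ⟨?_, ?_, ?_⟩ <;> rw [three_apply]
          · rw [if_pos rfl]; omega
          · rw [if_neg hij₀, if_pos rfl]; omega
          · rw [if_neg (Ne.symm hli), if_neg (Ne.symm hlj), if_pos rfl]; omega
      have he : e₀ = V1 ∨ e₀ = V2 := by
        have hee : e₀ = (if ¬ gd V1 then V1 else V2) := by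
          show (if h : Bad4.Nonempty then Finsupp.single (Bad4.min' h) 4
            else if ¬ gd V1 then V1 else V2) = _
          rw [dif_neg hB4]
        rw [hee]
        split_ifs <;> simp
      obtain ⟨h1, h2, h3⟩ := hpos e₀ he
      exact two_ne_of_three_pos hij₀ (Ne.symm hlj) (Ne.symm hli) h1 h2 h3
  · -- injectivity on cross pairs
    intro p hp q hq hΨ
    have hp' : p.1 ≠ p.2 := fun h => hp (by rw [h])
    have hq' : q.1 ≠ q.2 := fun h => hq (by rw [h])
    by_cases hp1 : gd (A p) <;> by_cases hq1 : gd (A q)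
    · -- both beyond branch A
      by_cases hp2 : ¬ gd (A p.swap) ∨ p.1 < p.2 <;> by_cases hq2 : ¬ gd (A q.swap) ∨ q.1 < q.2
      · -- B = B
        rw [hΨB p hp1 hp2, hΨB q hq1 hq2] at hΨ
        rcases two_two_eq_two_two hp' hΨ with ⟨ha, hb⟩ | ⟨ha, hb⟩
        · exact Prod.ext ha.symm hb.symm
        · -- swapped: contradiction with the branch conditions
          exfalso
          have hqs : q = p.swap := Prod.ext ha hb
          rw [hqs] at hq1 hq2
          simp only [Prod.swap_swap, Prod.fst_swap, Prod.snd_swap] at hq1 hq2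
          rcases hp2 with hp2 | hp2
          · exact hp2 hq1
          · rcases hq2 with hq2 | hq2
            · exact hq2 hp1
            · exact lt_asymm hp2 hq2
      · -- B vs C/D
        exfalso
        rw [hΨB p hp1 hp2] at hΨ
        obtain ⟨_, hb₀ne, hq2ne, -, -, -⟩ := hspecial q hq hq1 hq2
        by_cases hq3 : q.2 = b₀ q.1
        · rw [hΨC q hq1 hq2 hq3] at hΨ
          exact two_ne_single hp' (by norm_num) (by norm_num) hΨ
        · rw [hΨD q hq1 hq2 hq3] at hΨ
          have hpos := one_one_two_pos hq3 hq2ne hb₀ne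
          exact two_ne_of_three_pos hq3 hb₀ne hq2ne hpos.1 hpos.2.1 hpos.2.2 hΨ
      · exfalso
        rw [hΨB q hq1 hq2] at hΨ
        obtain ⟨_, hb₀ne, hp2ne, -, -, -⟩ := hspecial p hp hp1 hp2
        by_cases hp3 : p.2 = b₀ p.1
        · rw [hΨC p hp1 hp2 hp3] at hΨ
          exact two_ne_single hq' (by norm_num) (by norm_num) hΨ.symm
        · rw [hΨD p hp1 hp2 hp3] at hΨ
          have hpos := one_one_two_pos hp3 hp2ne hb₀ne
          exact two_ne_of_three_pos hp3 hb₀ne hp2ne hpos.1 hpos.2.1 hpos.2.2 hΨ.symm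
      · -- C/D vs C/D
        obtain ⟨_, hpb₀ne, hp2ne, -, -, -⟩ := hspecial p hp hp1 hp2
        obtain ⟨_, hqb₀ne, hq2ne, -, -, -⟩ := hspecial q hq hq1 hq2
        by_cases hp3 : p.2 = b₀ p.1 <;> by_cases hq3 : q.2 = b₀ q.1
        · rw [hΨC p hp1 hp2 hp3, hΨC q hq1 hq2 hq3] at hΨ
          have h1 : p.1 = q.1 := (Finsupp.single_left_inj (by norm_num)).mp hΨ
          refine Prod.ext h1 ?_
          rw [hp3, hq3, h1]
        · exfalso
          rw [hΨC p hp1 hp2 hp3, hΨD q hq1 hq2 hq3] at hΨ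
          have hpos := one_one_two_pos hq3 hq2ne hqb₀ne
          exact single_ne_of_three_pos hq3 hqb₀ne hq2ne hpos.1 hpos.2.1 hpos.2.2 hΨ
        · exfalso
          rw [hΨD p hp1 hp2 hp3, hΨC q hq1 hq2 hq3] at hΨ
          have hpos := one_one_two_pos hp3 hp2ne hpb₀ne
          exact single_ne_of_three_pos hp3 hpb₀ne hp2ne hpos.1 hpos.2.1 hpos.2.2 hΨ.symm
        · rw [hΨD p hp1 hp2 hp3, hΨD q hq1 hq2 hq3] at hΨ
          have h1 : p.1 = q.1 := one_one_two_eq_fst hp2ne hpb₀ne hq3 hΨ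
          have hb : b₀ p.1 = b₀ q.1 := by rw [h1]
          have hΨu : Finsupp.single p.2 1 + Finsupp.single (b₀ p.1) 1 + Finsupp.single p.1 2 =
              Finsupp.single q.2 1 + Finsupp.single (b₀ q.1) 1 + Finsupp.single q.1 2 := hΨ
          rw [← hb] at hΨu
          have h2 : p.2 = q.2 := one_one_two_eq_snd hp3 hp2ne h1 hΨu
          exact Prod.ext h1 h2
    · -- p beyond A, q in A
      exfalso
      rw [hΨA q hq1] at hΨ
      by_cases hp2 : ¬ gd (A p.swap) ∨ p.1 < p.2
      · rw [hΨB p hp1 hp2] at hΨ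
        exact one_three_ne_two_two hq' hΨ.symm
      · obtain ⟨_, hb₀ne, hp2ne, -, -, -⟩ := hspecial p hp hp1 hp2
        by_cases hp3 : p.2 = b₀ p.1
        · rw [hΨC p hp1 hp2 hp3] at hΨ
          exact two_ne_single hq' (by norm_num) (by norm_num) hΨ.symm
        · rw [hΨD p hp1 hp2 hp3] at hΨ
          have hpos := one_one_two_pos hp3 hp2ne hb₀ne
          exact two_ne_of_three_pos hp3 hb₀ne hp2ne hpos.1 hpos.2.1 hpos.2.2 hΨ.symm
    · exfalso
      rw [hΨA p hp1] at hΨ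
      by_cases hq2 : ¬ gd (A q.swap) ∨ q.1 < q.2
      · rw [hΨB q hq1 hq2] at hΨ
        exact one_three_ne_two_two hp' hΨ
      · obtain ⟨_, hb₀ne, hq2ne, -, -, -⟩ := hspecial q hq hq1 hq2
        by_cases hq3 : q.2 = b₀ q.1
        · rw [hΨC q hq1 hq2 hq3] at hΨ
          exact two_ne_single hp' (by norm_num) (by norm_num) hΨ
        · rw [hΨD q hq1 hq2 hq3] at hΨ
          have hpos := one_one_two_pos hq3 hq2ne hb₀ne
          exact two_ne_of_three_pos hq3 hb₀ne hq2ne hpos.1 hpos.2.1 hpos.2.2 hΨ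
    · -- A = A
      rw [hΨA p hp1, hΨA q hq1] at hΨ
      obtain ⟨ha, hb⟩ := eq_of_two_eq_two hp' (by norm_num) (by norm_num) (by norm_num) hΨ
      exact Prod.ext ha.symm hb.symm

/-- **Counting core for `D = 4` in chart vocabulary** (`m ≥ 3`, `c` non-constant):
`#invMonomials 4 c + #{(i,j) : c_i ≠ c_j} < #degMonomials (Fin m) 4`.
[cite: BurgisserIkenmeyer2017, §2.1 ("almost all w ∈ Sym^D ℂ^m have a trivial stabilizer")] -/
theorem card_invMonomials_add_card_lt_four (hm : 3 ≤ m) (c : Fin m → K)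
    (hnc : ∃ i j, c i ≠ c j) :
    (invMonomials 4 c).card + (Finset.univ.filter fun q : Fin m × Fin m => c q.1 ≠ c q.2).card <
      (degMonomials (Fin m) 4).card := by
  rw [invMonomials_eq_filter]
  have := core_four hm c hnc
  omega

end TrivialStabilizerCount

end Literature.Computability.AlgebraicComplexity

end
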